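import Summits.Parity.BatemanHorn.Theorems.AlmostPrimeZerosSystemMomentDeficitLinearSystems
import Summits.Parity.BatemanHorn.Theorems.AlmostPrimeZerosSystemMomentDeficitK1OfRoughClassDeficit
import Summits.Parity.BatemanHorn.Theorems.AlmostPrimeZerosSystemMomentDeficitRCDOfRoughAPLower
import Summits.Parity.BatemanHorn.Theorems.AlmostPrimeZerosSystemMomentDeficitRoughAPLowerLinear

/-!
# Crux `SystemMomentDeficit` (stmt-Parity-11326), line `Ideator3Sketch`: the crux from RAL(deg ≥ 2) alone

The registered skeleton `Cruxes/SystemMomentDeficit/Lines/Ideator3Sketch.lean` composes the crux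
`Summit.Parity.BatemanHorn.Theses.AlmostPrimeZeros.SystemMomentDeficit` BY NAME from seven registered
stubs, six of which are theorems of the tree.  This file records the resulting CONDITIONAL closure as a
tree theorem importing only landed modules (no restated stubs):

* `roughAPLower_of_roughAPLower_two_le` — RAL for every irreducible `g` of positive degree from RAL for
  degree `≥ 2` (the degree-1 case is the tree theorem `stub_roughAPLower_linear`);
* `systemMomentDeficit_of_roughAPLower` — **RAL(deg ≥ 2) → the crux**, by
  bridge 2 (`stub_roughClassDeficit_of_roughAPLower`, RAL → RCD), bridge 1
  (`decorrelatedCovarianceBound_of_roughClassDeficit`, RCD → K1) and the reduction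
  `systemMomentDeficit_of_decorrelatedCovarianceBound` (K1 → crux: assembly + CRT pair count +
  prime-pair tail + Mertens window + near-pair covariance + pair bookkeeping, all landed).

So the ONE remaining hypothesis of the line is the single-polynomial statement RAL(deg ≥ 2): for
`g ∈ ℤ[X]` irreducible of degree `≥ 2` with positive leading coefficient there is `C` such that for all
`x ≥ 16`, all prime powers `q ∈ PP(⌊x^{1/4}⌋)` (primes and prime squares) and all residues `r < q`,
`E(N_g ; n ≡ r (mod q)) ≥ (1/q) E(N_g) − C Λ(q)/(q log x)`, where
`N_g(n) = s(g(n)⁺) − #{r' ∈ PP(x) : r' ∣ g(n)⁺ ≠ 0}` is the capped count of the prime factors `> x` and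
prime-square factors `> x` of `g(n)⁺` and `E` is the mean over `0 ≤ n ≤ x` — rough (⇔ `x`-friable)
values of ONE polynomial of degree `≥ 2` in the residue classes of small prime powers, one-sided, to
relative order `log q/log x` (heuristic: Dickman; first open instance `g = X²+1`).  This is a
`proof.conditional` record by design: RAL(deg ≥ 2) is not a published theorem (for degree `≥ 2` no
equidistribution of rough/friable values of `g` in residue classes of a growing modulus is known at any
rate; `Ψ_g(x, x)` itself has no unconditional asymptotic), so it is taken as an explicit hypothesis,
never as a Literature fact.  Everything in the proof is [folklore] composition of landed theorems.
-/

namespace Summit.Parity.BatemanHorn.Cruxes.SystemMomentDeficit.Ideator3Sketch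

open scoped BigOperators
open Finset Polynomial
open Literature.NumberTheory.Sieve

/-- **RAL for every irreducible polynomial of positive degree, from RAL in degree `≥ 2`.**  The
degree-1 case is the tree theorem `stub_roughAPLower_linear` (a linear value `≤ A x` has a prime factor
`> x` only with cofactor `< A`, so `E N_g ≪ 1/log x` and the one-sided bound is free). -/
theorem roughAPLower_of_roughAPLower_two_le :
    (∀ g : ℤ[X], Irreducible g → 2 ≤ g.natDegree → 0 < g.leadingCoeff →
      ∃ C : ℝ, ∀ x : ℕ, 16 ≤ x →
        ∀ q ∈ (Nat.primesLE (Nat.sqrt (Nat.sqrt x)) ∪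
            ((Nat.primesLE (Nat.sqrt (Nat.sqrt x))).filter
              (fun p => p ^ 2 ≤ Nat.sqrt (Nat.sqrt x))).image (fun p => p ^ 2)),
          ∀ r : ℕ, r < q →
            1 / (q : ℝ) * ((∑ n ∈ Finset.range (x + 1),
                (((((g.eval (n : ℤ)).toNat.factorization.sum fun _ v => min v 2) : ℕ) : ℝ) -
                (#((Nat.primesLE x ∪ ((Nat.primesLE x).filter (fun p => p ^ 2 ≤ x)).image (fun p => p ^ 2)).filter
                  (fun r' => r' ∣ (g.eval (n : ℤ)).toNat ∧ (g.eval (n : ℤ)).toNat ≠ 0)) : ℝ))) / ((x : ℝ) + 1)) -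
              C * ArithmeticFunction.vonMangoldt q / ((q : ℝ) * Real.log x) ≤
            (∑ n ∈ (Finset.range (x + 1)).filter (fun n : ℕ => n % q = r),
                (((((g.eval (n : ℤ)).toNat.factorization.sum fun _ v => min v 2) : ℕ) : ℝ) -
                (#((Nat.primesLE x ∪ ((Nat.primesLE x).filter (fun p => p ^ 2 ≤ x)).image (fun p => p ^ 2)).filter
                  (fun r' => r' ∣ (g.eval (n : ℤ)).toNat ∧ (g.eval (n : ℤ)).toNat ≠ 0)) : ℝ))) / ((x : ℝ) + 1)) →
    ∀ g : ℤ[X], Irreducible g → 0 < g.natDegree → 0 < g.leadingCoeff →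
      ∃ C : ℝ, ∀ x : ℕ, 16 ≤ x →
        ∀ q ∈ (Nat.primesLE (Nat.sqrt (Nat.sqrt x)) ∪
            ((Nat.primesLE (Nat.sqrt (Nat.sqrt x))).filter
              (fun p => p ^ 2 ≤ Nat.sqrt (Nat.sqrt x))).image (fun p => p ^ 2)),
          ∀ r : ℕ, r < q →
            1 / (q : ℝ) * ((∑ n ∈ Finset.range (x + 1),
                (((((g.eval (n : ℤ)).toNat.factorization.sum fun _ v => min v 2) : ℕ) : ℝ) -
                (#((Nat.primesLE x ∪ ((Nat.primesLE x).filter (fun p => p ^ 2 ≤ x)).image (fun p => p ^ 2)).filter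
                  (fun r' => r' ∣ (g.eval (n : ℤ)).toNat ∧ (g.eval (n : ℤ)).toNat ≠ 0)) : ℝ))) / ((x : ℝ) + 1)) -
              C * ArithmeticFunction.vonMangoldt q / ((q : ℝ) * Real.log x) ≤
            (∑ n ∈ (Finset.range (x + 1)).filter (fun n : ℕ => n % q = r),
                (((((g.eval (n : ℤ)).toNat.factorization.sum fun _ v => min v 2) : ℕ) : ℝ) -
                (#((Nat.primesLE x ∪ ((Nat.primesLE x).filter (fun p => p ^ 2 ≤ x)).image (fun p => p ^ 2)).filter
                  (fun r' => r' ∣ (g.eval (n : ℤ)).toNat ∧ (g.eval (n : ℤ)).toNat ≠ 0)) : ℝ))) / ((x : ℝ) + 1) := by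
  intro hRAL g hirr hdeg hlc
  by_cases h1 : g.natDegree = 1
  · exact stub_roughAPLower_linear g h1 hlc
  · exact hRAL g hirr (by omega) hlc

/-- **The crux `SystemMomentDeficit` from RAL(deg ≥ 2) alone (line `Ideator3Sketch`, conditional
closure).**  If every irreducible `g ∈ ℤ[X]` of degree `≥ 2` with positive leading coefficient satisfies
the one-sided rough-values-in-residue-classes bound RAL (docstring of this module), then for every
Bateman–Horn system `f` the moment deficit `m₁(x) − v(x)` of the capped prime-factor statistic `s_f` is
bounded above, i.e. `Summit.Parity.BatemanHorn.Theses.AlmostPrimeZeros.SystemMomentDeficit` holds.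
Proof: RAL(all degrees) by `roughAPLower_of_roughAPLower_two_le`; RCD by bridge 2
`stub_roughClassDeficit_of_roughAPLower`; K1 by bridge 1 `decorrelatedCovarianceBound_of_roughClassDeficit`;
the crux by `systemMomentDeficit_of_decorrelatedCovarianceBound`. -/
theorem systemMomentDeficit_of_roughAPLower :
    (∀ g : ℤ[X], Irreducible g → 2 ≤ g.natDegree → 0 < g.leadingCoeff →
      ∃ C : ℝ, ∀ x : ℕ, 16 ≤ x →
        ∀ q ∈ (Nat.primesLE (Nat.sqrt (Nat.sqrt x)) ∪
            ((Nat.primesLE (Nat.sqrt (Nat.sqrt x))).filter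
              (fun p => p ^ 2 ≤ Nat.sqrt (Nat.sqrt x))).image (fun p => p ^ 2)),
          ∀ r : ℕ, r < q →
            1 / (q : ℝ) * ((∑ n ∈ Finset.range (x + 1),
                (((((g.eval (n : ℤ)).toNat.factorization.sum fun _ v => min v 2) : ℕ) : ℝ) -
                (#((Nat.primesLE x ∪ ((Nat.primesLE x).filter (fun p => p ^ 2 ≤ x)).image (fun p => p ^ 2)).filter
                  (fun r' => r' ∣ (g.eval (n : ℤ)).toNat ∧ (g.eval (n : ℤ)).toNat ≠ 0)) : ℝ))) / ((x : ℝ) + 1)) -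
              C * ArithmeticFunction.vonMangoldt q / ((q : ℝ) * Real.log x) ≤
            (∑ n ∈ (Finset.range (x + 1)).filter (fun n : ℕ => n % q = r),
                (((((g.eval (n : ℤ)).toNat.factorization.sum fun _ v => min v 2) : ℕ) : ℝ) -
                (#((Nat.primesLE x ∪ ((Nat.primesLE x).filter (fun p => p ^ 2 ≤ x)).image (fun p => p ^ 2)).filter
                  (fun r' => r' ∣ (g.eval (n : ℤ)).toNat ∧ (g.eval (n : ℤ)).toNat ≠ 0)) : ℝ))) / ((x : ℝ) + 1)) →
    Summit.Parity.BatemanHorn.Theses.AlmostPrimeZeros.SystemMomentDeficit :=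
  fun hRAL => systemMomentDeficit_of_decorrelatedCovarianceBound
    (decorrelatedCovarianceBound_of_roughClassDeficit
      (stub_roughClassDeficit_of_roughAPLower (roughAPLower_of_roughAPLower_two_le hRAL)))

end Summit.Parity.BatemanHorn.Cruxes.SystemMomentDeficit.Ideator3Sketch
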